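import Summits.BirchSwinnertonDyer.Rank1Residual.Additive.TameBranchLambdaParityRankOne
import Summits.BirchSwinnertonDyer.Rank1Residual.Additive.TameBranchLambdaParityRankZero
import HarnessLib

/-!
# THE μ-PART ON DEFECT 2 — an INTEGRAL image `ι g = u·ϖ·B` with a FIRST UNIT coefficient at `n`
# gives `μ(char_Λ X) = 0` and `λ ≤ n` as THEOREMS; the parity squeeze then runs with NO `μ`-hypothesis
# and lands the INTEGRAL main conjecture at the pair `char_Λ X = (g)`
# (cell `b2b-bsdres`, sub-cell additive-p2 = X3♯(G-ord)/X4♯(G-ord), gen 31; part 2 — per datum)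

HONEST FRAMING (cell `b2b-bsdres`, run/shared/lean/b2b/bsd-rank1-residual/, verbatim in every
file): the goal of the cell is to DELETE the COMBINATION-SHAPED residual classes of the
Birch–Swinnerton-Dyer formula for ALL analytic-rank `≤ 1` elliptic curves over `ℚ` — "full BSD
formula for every rank `≤ 1` curve in class `C`" assembled STRICTLY from published theorems — so
that the rank-`≤ 1` remainder becomes exactly the CONSTRUCTION-SHAPED classes, which are TYPED
(missing-input `Prop`s), NOT attempted. This is not "finishing BSD". Sub-cell additive-p2: the
classes X3♯(G-ord) / X4♯(G-ord) are CONSTRUCTION-SHAPED and stay so; labels / RESIDUAL-MAP marks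
UNCHANGED; nothing is booked. Theorems only (pure algebra of `Λ = ℤ_p⟦T⟧` plus the hypothesis binders
`LeadingTermClauses W p Dh` = Delbourgo 2002 (B) and `prop310_selmerCorank_mod_two_eq_lambdaInvariant` =
Greenberg 1999 Prop. 3.10); no definition, no named fact, no `sorry`.

## What and why

On the tame-branch route the per-pair residual of the main conjecture (G) at a pair with
`λ_an ≤ rank + 2` was, after gen 30, **`μ(X(E/ℚ_∞)) = 0` ALONE** — an INTEGRAL (C), not in print off
defect 2. ON DEFECT 2 the integral divisibility IS in the tree: gen 19's full-series bricks
(`isTorsion_and_exists_iota_eq_branch_of_katoComponent` / `…_of_wuthrichComponent`, Kato 2004 Thm. 17.4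
(3) / Wuthrich 2014 Thm. 16 through [C] and the eigen-descent) give `g ∈ char_Λ X(E/ℚ_∞)` with
**`ι g = C(u·ϖ)·B_{(p−1)/2}(f♭, α)`**, `u ∈ ℤ_p^×`, `ϖ` the period ratio — an identity whose right side is
automatically INTEGRAL (`‖[Tʲ]ι g‖ ≤ 1`). This file is the per-datum Λ-algebra of that shape:

* §1 **`μ = 0` and `λ = n` from the FIRST UNIT coefficient** (`mu_eq_zero_and_lam_eq_of_iota_eq_of_firstUnit`:
  `‖[Tⁿ]X‖ = 1`, `‖[Tⁱ]X‖ < 1` for `i < n` ⟹ `μ(g) = 0`, `λ(g) = n`; for a generator `fE ∣ g`: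
  **`μ(fE) = 0`**, `λ(fE) ≤ n` — gen 19's `n = 1` certificate at every index) and the generator
  RESCALING `exists_span_eq_and_iota_eq_C_zpow_mul` (`ι g₁ = C(v)·X`, `B = C(c)·X`, `v, c ≠ 0` ⟹
  `(g) = (g₁)` for some `g` with `ι g = p^k·B`, `k ∈ ℤ` — the bridge to cc-typer-2's
  `TameBranchRatCharEqAt` shape, used in part 4).
* §2 **THE PARITY SQUEEZE WITH THE μ-HYPOTHESIS DISCHARGED** (gen 30's
  `charIdeal_eq_span_and_iota_eq_of_squeeze_rank{One,Zero}` at `(k, c, m) = (0, 0, 0)` + injectivity of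
  `ι`): rank 1, first unit index `3`, `[T¹]X ≠ 0`, `1 + 2t < v + ord_p ∏c` with `v ≤ ord_p Reg_p(E,Dh)`
  ⟹ `μ(fE) = 0`, `λ(fE) = 3` and **`char_Λ X = (g)`** — the main conjecture at the pair, INTEGRALLY,
  in the Kato-brick currency (`charIdeal_eq_span_of_iota_eq_of_firstUnit_three_rankOne`); rank 0, first
  unit index `2`, `2t < ord_p ∏c` ⟹ the same (`…_firstUnit_two_rankZero`).
* §3 the μ-FREE two-sided sandwich on the integral shape (`sandwich_rankOne/rankZero_of_iota_eq_of_firstUnit`):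
  `r + 2t ≤ LHS ≤ v_p([Tʳ]X) + r + 2t`, left `=` iff `λ(X) = r`, right `=` iff `λ(X) = n`, `λ(X) ≡ r
  (mod 2)` — every term now a finite datum or a theorem.

Part 3 adds the FULL squeeze on this shape (any `n`; `Ш[p^∞] = 0`, `ℓ = 1`), part 4 the class-level
forms on X4♯(G-ord) ∩ `I₀*` ∩ {`ρ̄` onto} (`p ≥ 5`) and X3♯(G-ord) ∩ `I₀*`, where the conclusion is
cc-typer-2's typed rational main conjecture `TameBranchRatCharEqAt W p`. Nothing booked; labels UNCHANGED.

References: Kato 2004 Thm. 17.4 (3) [Kato2004Asterisque]; Wuthrich 2014 Thm. 16 [Wuthrich2014];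
Delbourgo 2002 Thm. (B) p. 40 [Delbourgo2002]; Greenberg LNM 1716 Prop. 3.10, §4, §5 p. 183
[GreenbergLNM1716]; Greenberg–Vatsal 2000 p. 4 [GreenbergVatsal2000]; Washington GTM 83 §7.1
[Washington1997]; `GordRankOneKatoCertificate.lean` (gen 19), `TameBranchLambdaParity*.lean` (gen 30),
`X1/ParitySqueeze.lean` (eisenstein-p1, route P at good ordinary `p`). -/

set_option autoImplicit false

noncomputable section

open scoped Classical MatrixGroups ModularForm NumberField

open CongruenceSubgroup IsDedekindDomain WeierstrassCurve NumberField
  Literature.NumberTheory.EllipticCurves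
  Literature.NumberTheory.EllipticCurves.ModularForms
  Literature.NumberTheory.EllipticCurves.Rank1Residual
  Literature.NumberTheory.EllipticCurves.Rank1Residual.Typed
  Literature.NumberTheory.EllipticCurves.Delbourgo2002
  Literature.NumberTheory.EllipticCurves.Greenberg1999
  Summit.BirchSwinnertonDyer.Rank1Residual.X1.MuLambda
  Summit.BirchSwinnertonDyer.Rank1Residual.X1.RankOneParitySqueeze
  Summit.BirchSwinnertonDyer.Rank1Residual.X11a.LambdaNorm

namespace Summit.BirchSwinnertonDyer.Rank1Residual.Additive

namespace TameBranchMuPart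

/-! ### §1 Λ-algebra: an integral image with a first unit coefficient -/

section Algebra

variable {p : ℕ} [hp : Fact p.Prime]

/-- The image `ι g ∈ ℚ_p⟦T⟧` of `g ∈ Λ = ℤ_p⟦T⟧` is INTEGRAL: `‖[Tʲ]ι g‖ ≤ 1 = p⁰`. [folklore] -/
theorem norm_coeff_le_pow_zero_of_iota_eq {g : IwasawaAlgebra p} {X : PowerSeries ℚ_[p]}
    (hι : iwasawaToPowerSeries p g = X) (j : ℕ) : ‖PowerSeries.coeff j X‖ ≤ (p : ℝ) ^ (0 : ℕ) := by
  rw [pow_zero, ← hι, Wuthrich2014.coeff_iwasawaToPowerSeries p g j, PadicInt.padic_norm_e_of_padicInt]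
  exact PadicInt.norm_le_one _

/-- `ι g = X` is `ι g = C(p⁰)·X` (the shape of gens 29–30 with `k = 0`). [folklore] -/
theorem iota_eq_C_pow_zero_mul {g : IwasawaAlgebra p} {X : PowerSeries ℚ_[p]}
    (hι : iwasawaToPowerSeries p g = X) :
    iwasawaToPowerSeries p g = PowerSeries.C ((p : ℚ_[p]) ^ (0 : ℕ)) * X := by
  rw [pow_zero, map_one, one_mul, hι]

/-- **`μ = 0` AND `λ = n` FROM THE FIRST UNIT COEFFICIENT OF AN INTEGRAL IMAGE.** If `ι g = X` with
`‖[Tⁿ]X‖ = 1` and `‖[Tⁱ]X‖ < 1` for `i < n`, then `g ≠ 0`, **`μ(g) = 0`** and **`λ(g) = n`**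
(`X` is integral, so `p⁰` is a bound attained first at `n`: gen 29's `mu_add_eq_of_iota_eq` and
`lam_eq_of_iota_eq_of_firstTop` with `k = c = 0`). [cite: Washington1997, §7.1] -/
theorem mu_eq_zero_and_lam_eq_of_iota_eq_of_firstUnit {g : IwasawaAlgebra p} {X : PowerSeries ℚ_[p]}
    (hι : iwasawaToPowerSeries p g = X) {n : ℕ} (hn : ‖PowerSeries.coeff n X‖ = 1)
    (hlt : ∀ i < n, ‖PowerSeries.coeff i X‖ < 1) : g ≠ 0 ∧ mu g = 0 ∧ lam g = n := by
  have hι' := iota_eq_C_pow_zero_mul hι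
  have hbd := norm_coeff_le_pow_zero_of_iota_eq hι
  have hn' : ‖PowerSeries.coeff n X‖ = (p : ℝ) ^ (0 : ℕ) := by rw [pow_zero]; exact hn
  have hlt' : ∀ i < n, ‖PowerSeries.coeff i X‖ < (p : ℝ) ^ (0 : ℕ) := fun i hi ↦ by
    rw [pow_zero]; exact hlt i hi
  have hg0 : g ≠ 0 := by
    intro h0
    have e : PowerSeries.coeff n X = 0 := by rw [← hι, h0, map_zero, map_zero]
    rw [e, norm_zero] at hn
    exact zero_ne_one hn
  have hμ : mu g + 0 = 0 := TameBranchExtraZeros.mu_add_eq_of_iota_eq hg0 hι' hbd hn'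
  exact ⟨hg0, by rw [add_zero] at hμ; exact hμ,
    TameBranchExtraZeros.lam_eq_of_iota_eq_of_firstTop hg0 hι' hbd hn' hlt'⟩

/-- **Generator form**: `fE ∣ g`, `ι g = X` with first unit coefficient at `n` ⟹ **`μ(fE) = 0`** and
`λ(fE) ≤ n` (`μ`, `λ` are additive on non-zero elements). Gen 19's one-number certificate
(`mu_eq_zero_and_lam_le_one_of_dvd`) is the case `n = 1`. [cite: Washington1997, §7.1] -/
theorem mu_eq_zero_and_lam_le_of_dvd_of_firstUnit {fE g : IwasawaAlgebra p} (hdvd : fE ∣ g)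
    {X : PowerSeries ℚ_[p]} (hι : iwasawaToPowerSeries p g = X) {n : ℕ}
    (hn : ‖PowerSeries.coeff n X‖ = 1) (hlt : ∀ i < n, ‖PowerSeries.coeff i X‖ < 1) :
    fE ≠ 0 ∧ mu fE = 0 ∧ lam fE ≤ n := by
  obtain ⟨h, rfl⟩ := hdvd
  obtain ⟨hg0, hμ, hlam⟩ := mu_eq_zero_and_lam_eq_of_iota_eq_of_firstUnit hι hn hlt
  have hfE : fE ≠ 0 := left_ne_zero_of_mul hg0
  have hh : h ≠ 0 := right_ne_zero_of_mul hg0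
  rw [mu_mul hfE hh] at hμ
  rw [lam_mul hfE hh] at hlam
  exact ⟨hfE, by omega, by omega⟩

/-- **RESCALING A GENERATOR (bridge to the `TameBranchRatCharEqAt` shape).** If `ι g₁ = C(v)·X` and
`B = C(c)·X` with `v, c ∈ ℚ_p^×`, then for some `g` generating the SAME ideal as `g₁` and some `k ∈ ℤ`:
**`ι g = p^k·B`** (`c/v = p^{−k}·w` with `w ∈ ℤ_p^×`, `g = C(w)·g₁`). Pure bookkeeping. [folklore] -/
theorem exists_span_eq_and_iota_eq_C_zpow_mul {g₁ : IwasawaAlgebra p} {v c : ℚ_[p]} (hv : v ≠ 0)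
    (hc : c ≠ 0) {X : PowerSeries ℚ_[p]} (hι : iwasawaToPowerSeries p g₁ = PowerSeries.C v * X) :
    ∃ (g : IwasawaAlgebra p) (k : ℤ), Ideal.span ({g} : Set (IwasawaAlgebra p)) = Ideal.span {g₁} ∧
      iwasawaToPowerSeries p g = PowerSeries.C ((p : ℚ_[p]) ^ k) * (PowerSeries.C c * X) := by
  have hpQ : (p : ℚ_[p]) ≠ 0 := Nat.cast_ne_zero.mpr hp.out.ne_zero
  have hw0 : c * v⁻¹ ≠ 0 := mul_ne_zero hc (inv_ne_zero hv)
  -- the unit part of `c/v`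
  have hnorm : ‖c * v⁻¹ * (p : ℚ_[p]) ^ (-(c * v⁻¹).valuation)‖ = 1 := by
    rw [norm_mul, Padic.norm_eq_zpow_neg_valuation hw0, norm_zpow, Padic.norm_p, inv_zpow',
      ← zpow_add₀ (by exact_mod_cast hp.out.ne_zero : (p : ℝ) ≠ 0)]
    simp
  set w : ℤ_[p] := ⟨c * v⁻¹ * (p : ℚ_[p]) ^ (-(c * v⁻¹).valuation), hnorm.le⟩ with hw
  have hwU : IsUnit w := PadicInt.isUnit_iff.mpr (by rw [PadicInt.norm_def]; exact hnorm)
  refine ⟨PowerSeries.C w * g₁, -(c * v⁻¹).valuation,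
    Ideal.span_singleton_mul_left_unit (hwU.map PowerSeries.C) g₁, ?_⟩
  have hφ : algebraMap ℤ_[p] ℚ_[p] w = c * v⁻¹ * (p : ℚ_[p]) ^ (-(c * v⁻¹).valuation) := rfl
  rw [map_mul, PowerSeries.map_C, hφ, hι, ← mul_assoc, ← map_mul, ← mul_assoc, ← map_mul]
  congr 2
  field_simp

end Algebra

/-! ### §2 The parity squeeze with the `μ`-hypothesis DISCHARGED (integral shape) -/

section Squeeze

open TameBranchExtraZeros TameBranchLambdaParity

variable {W : WeierstrassCurve ℚ} [W.IsElliptic] [W.IsGloballyMinimal] {p : ℕ} [hp : Fact p.Prime]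

/-- **RANK ONE, first unit index `3`: the INTEGRAL main conjecture at the pair.** `p ≠ 2`,
`rank_ℤ E(ℚ) = 1`, a (B)-datum `Dh`, Greenberg's Prop. 3.10, a cyclotomic dual datum `D` with `X`
torsion and generator `fE`, `g ∈ char_Λ X` with INTEGRAL image `ι g = X` (defect 2: `X = u·ϖ·B_{(p−1)/2}`),
first unit coefficient of `X` at `3`, `[T¹]X ≠ 0`, and the squeeze witness `1 + 2·ord_p #E(ℚ)_tors <
v + ord_p ∏c_ℓ` for a certified `v ≤ ord_p Reg_p(E,Dh)`. Then **`μ(fE) = 0`** (theorem, §1),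
**`λ(fE) = 3`** and **`char_Λ X = (g)`**: the characteristic ideal IS generated by the element with
image `X` — route P of eisenstein-p1 on the additive defect-2 rows, `m = 0` discharged by integrality.
[cite: GreenbergLNM1716, Prop. 3.10 and §5 p. 183] [cite: Delbourgo2002, Theorem (B) (p. 40)]
[cite: Washington1997, §7.1] -/
theorem charIdeal_eq_span_of_iota_eq_of_firstUnit_three_rankOne
    (h310 : prop310_selmerCorank_mod_two_eq_lambdaInvariant) (hp2 : p ≠ 2)
    (hr1 : W.mordellWeilRank = 1) {Dh : PAdicHeightData W p} (hBcl : LeadingTermClauses W p Dh)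
    {κ : ZpExtension ℚ p} {γ : Field.absoluteGaloisGroup ℚ}
    (hκ : κ.IsCyclotomic) (hγ : κ.IsTopGenerator γ) (hγ' : IsCyclotomicVariable p γ)
    (D : W.SelmerDualData κ γ) [Module.Finite (IwasawaAlgebra p) D.X] (hX : D.IsTorsion)
    {fE g : IwasawaAlgebra p} (hchar : D.charIdeal = Ideal.span {fE}) (hg : g ∈ D.charIdeal)
    {X : PowerSeries ℚ_[p]} (hι : iwasawaToPowerSeries p g = X)
    (hn : ‖PowerSeries.coeff 3 X‖ = 1) (hlt : ∀ i < 3, ‖PowerSeries.coeff i X‖ < 1)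
    (hX1 : PowerSeries.coeff 1 X ≠ 0) {v : ℤ} (hv : v ≤ (padicRegulator Dh).valuation)
    (hb : (1 : ℤ) + 2 * padicValNat p W.torsionOrder < v + padicValNat p W.tamagawaProduct) :
    mu fE = 0 ∧ lam fE = 3 ∧ D.charIdeal = Ideal.span {g} := by
  have hdvd : fE ∣ g := by
    have hg' := hg
    rw [hchar] at hg'
    exact Ideal.mem_span_singleton.mp hg'
  obtain ⟨-, hμ, -⟩ := mu_eq_zero_and_lam_le_of_dvd_of_firstUnit hdvd hι hn hlt
  have hn' : ‖PowerSeries.coeff 3 X‖ = (p : ℝ) ^ (0 : ℕ) := by rw [pow_zero]; exact hn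
  have hlt' : ∀ i < 3, ‖PowerSeries.coeff i X‖ < (p : ℝ) ^ (0 : ℕ) := fun i hi ↦ by
    rw [pow_zero]; exact hlt i hi
  obtain ⟨hlam, G, hG, -, -, hιG⟩ := charIdeal_eq_span_and_iota_eq_of_squeeze_rankOne h310 hp2 hr1
    hBcl hκ hγ hγ' D hX hchar hg (iota_eq_C_pow_zero_mul hι) (norm_coeff_le_pow_zero_of_iota_eq hι)
    hn' hlt' hX1 (m := 0) hμ.le hv (by rw [Nat.cast_zero, zero_add]; exact hb)
  rw [hμ, add_zero, pow_zero, map_one, one_mul, ← hι] at hιG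
  exact ⟨hμ, hlam, by rw [hG, iwasawaToPowerSeries_injective p hιG]⟩

/-- **RANK ZERO, first unit index `2`: the INTEGRAL main conjecture at the pair.** `p ≠ 2`,
`rank_ℤ E(ℚ) = 0`, a (B)-datum, Greenberg's Prop. 3.10, `g ∈ char_Λ X = (fE)` with integral image
`ι g = X`, first unit coefficient at `2`, `X(0) ≠ 0`, and the squeeze witness
`2·ord_p #E(ℚ)_tors < ord_p ∏c_ℓ`. Then **`μ(fE) = 0`**, **`λ(fE) = 2`** and **`char_Λ X = (g)`** —
Greenberg's `147b1@13` squeeze on the additive defect-2 rows, unconditionally in `μ`.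
[cite: GreenbergLNM1716, Prop. 3.10 and §5 p. 183] [cite: Delbourgo2002, Theorem (B) (p. 40)]
[cite: Washington1997, §7.1] -/
theorem charIdeal_eq_span_of_iota_eq_of_firstUnit_two_rankZero
    (h310 : prop310_selmerCorank_mod_two_eq_lambdaInvariant) (hp2 : p ≠ 2)
    (hr0 : W.mordellWeilRank = 0) {Dh : PAdicHeightData W p} (hBcl : LeadingTermClauses W p Dh)
    {κ : ZpExtension ℚ p} {γ : Field.absoluteGaloisGroup ℚ}
    (hκ : κ.IsCyclotomic) (hγ : κ.IsTopGenerator γ) (hγ' : IsCyclotomicVariable p γ)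
    (D : W.SelmerDualData κ γ) [Module.Finite (IwasawaAlgebra p) D.X] (hX : D.IsTorsion)
    {fE g : IwasawaAlgebra p} (hchar : D.charIdeal = Ideal.span {fE}) (hg : g ∈ D.charIdeal)
    {X : PowerSeries ℚ_[p]} (hι : iwasawaToPowerSeries p g = X)
    (hn : ‖PowerSeries.coeff 2 X‖ = 1) (hlt : ∀ i < 2, ‖PowerSeries.coeff i X‖ < 1)
    (hX0 : PowerSeries.constantCoeff X ≠ 0)
    (hb : 2 * padicValNat p W.torsionOrder < padicValNat p W.tamagawaProduct) :
    mu fE = 0 ∧ lam fE = 2 ∧ D.charIdeal = Ideal.span {g} := by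
  have hdvd : fE ∣ g := by
    have hg' := hg
    rw [hchar] at hg'
    exact Ideal.mem_span_singleton.mp hg'
  obtain ⟨-, hμ, -⟩ := mu_eq_zero_and_lam_le_of_dvd_of_firstUnit hdvd hι hn hlt
  have hn' : ‖PowerSeries.coeff 2 X‖ = (p : ℝ) ^ (0 : ℕ) := by rw [pow_zero]; exact hn
  have hlt' : ∀ i < 2, ‖PowerSeries.coeff i X‖ < (p : ℝ) ^ (0 : ℕ) := fun i hi ↦ by
    rw [pow_zero]; exact hlt i hi
  obtain ⟨hlam, G, hG, -, -, hιG⟩ := charIdeal_eq_span_and_iota_eq_of_squeeze_rankZero h310 hp2 hr0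
    hBcl hκ hγ hγ' D hX hchar hg (iota_eq_C_pow_zero_mul hι) (norm_coeff_le_pow_zero_of_iota_eq hι)
    hX0 hn' hlt' (m := 0) hμ.le (by rw [zero_add]; exact hb)
  rw [hμ, add_zero, pow_zero, map_one, one_mul, ← hι] at hιG
  exact ⟨hμ, hlam, by rw [hG, iwasawaToPowerSeries_injective p hιG]⟩

end Squeeze

/-! ### §3 The μ-FREE two-sided sandwich on the integral shape -/

section Sandwich

open TameBranchExtraZeros TameBranchLambdaParity

variable {W : WeierstrassCurve ℚ} [W.IsElliptic] [W.IsGloballyMinimal] {p : ℕ} [hp : Fact p.Prime]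

/-- **RANK ONE, μ-free sandwich.** With `ι g = X` integral, first unit index `n`, `[T¹]X ≠ 0`, a
(B)-datum and Prop. 3.10: Schneider, `#Ш[p^∞] < ∞`, **`μ(fE) = 0`**, `λ(fE)` ODD, `1 ≤ λ(fE) ≤ n`, and
with `LHS = ord_p #Ш[p^∞] + ord_p Reg_p + ord_p ∏c + ord_p ℓ`, `t = ord_p #tors`:
**`1 + 2t ≤ LHS ≤ v_p([T¹]X) + 1 + 2t`**, left `=` iff `λ(fE) = 1`, right `=` iff `λ(fE) = n` — every
quantity a finite datum (`v_p([T¹]X) = v_p(A′) − 1` in the census's currency) or a theorem.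
[cite: Delbourgo2002, Theorem (B) (p. 40)] [cite: GreenbergLNM1716, Prop. 3.10] [cite: Washington1997, §7.1] -/
theorem sandwich_rankOne_of_iota_eq_of_firstUnit
    (h310 : prop310_selmerCorank_mod_two_eq_lambdaInvariant) (hp2 : p ≠ 2)
    (hr1 : W.mordellWeilRank = 1) {Dh : PAdicHeightData W p} (hBcl : LeadingTermClauses W p Dh)
    {κ : ZpExtension ℚ p} {γ : Field.absoluteGaloisGroup ℚ}
    (hκ : κ.IsCyclotomic) (hγ : κ.IsTopGenerator γ) (hγ' : IsCyclotomicVariable p γ)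
    (D : W.SelmerDualData κ γ) [Module.Finite (IwasawaAlgebra p) D.X] (hX : D.IsTorsion)
    {fE g : IwasawaAlgebra p} (hchar : D.charIdeal = Ideal.span {fE}) (hg : g ∈ D.charIdeal)
    {X : PowerSeries ℚ_[p]} (hι : iwasawaToPowerSeries p g = X)
    {n : ℕ} (hn : ‖PowerSeries.coeff n X‖ = 1) (hlt : ∀ i < n, ‖PowerSeries.coeff i X‖ < 1)
    (hX1 : PowerSeries.coeff 1 X ≠ 0) :
    SchneiderConjecture Dh ∧ Finite (AddCommGroup.primaryComponent W.sha p) ∧ mu fE = 0 ∧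
      Odd (lam fE) ∧ 1 ≤ lam fE ∧ lam fE ≤ n ∧
      ∃ ℓ : ℕ, ℓ ∣ p ^ 2 ∧ (ReductionNonAnomalous W p → ℓ = 1) ∧
        (1 : ℤ) + 2 * padicValNat p W.torsionOrder ≤
          (padicValNat p (Nat.card (AddCommGroup.primaryComponent W.sha p)) : ℤ) +
            (padicRegulator Dh).valuation + padicValNat p W.tamagawaProduct + padicValNat p ℓ ∧
        ((1 : ℤ) + 2 * padicValNat p W.torsionOrder =
          (padicValNat p (Nat.card (AddCommGroup.primaryComponent W.sha p)) : ℤ) +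
            (padicRegulator Dh).valuation + padicValNat p W.tamagawaProduct + padicValNat p ℓ ↔
          lam fE = 1) ∧
        (padicValNat p (Nat.card (AddCommGroup.primaryComponent W.sha p)) : ℤ) +
            (padicRegulator Dh).valuation + padicValNat p W.tamagawaProduct + padicValNat p ℓ ≤
          (PowerSeries.coeff 1 X).valuation + 1 + 2 * padicValNat p W.torsionOrder ∧
        ((padicValNat p (Nat.card (AddCommGroup.primaryComponent W.sha p)) : ℤ) +
            (padicRegulator Dh).valuation + padicValNat p W.tamagawaProduct + padicValNat p ℓ =
          (PowerSeries.coeff 1 X).valuation + 1 + 2 * padicValNat p W.torsionOrder ↔ lam fE = n) := by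
  have hdvd : fE ∣ g := by
    have hg' := hg
    rw [hchar] at hg'
    exact Ideal.mem_span_singleton.mp hg'
  obtain ⟨-, hμ, -⟩ := mu_eq_zero_and_lam_le_of_dvd_of_firstUnit hdvd hι hn hlt
  have hn' : ‖PowerSeries.coeff n X‖ = (p : ℝ) ^ (0 : ℕ) := by rw [pow_zero]; exact hn
  have hlt' : ∀ i < n, ‖PowerSeries.coeff i X‖ < (p : ℝ) ^ (0 : ℕ) := fun i hi ↦ by
    rw [pow_zero]; exact hlt i hi
  obtain ⟨hS, hfin, hodd, h1, hle, -, ℓ, hℓp, hℓ1, hlow, hlowiff, hup, hupiff, -⟩ :=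
    sandwich_rankOne_of_iota_eq_of_firstTop h310 hp2 hr1 hBcl hκ hγ hγ' D hX hchar hg
      (iota_eq_C_pow_zero_mul hι) (norm_coeff_le_pow_zero_of_iota_eq hι) hn' hlt' hX1
  rw [hμ] at hlow hlowiff hup hupiff
  simp only [Nat.cast_zero, zero_add, add_zero] at hlow hlowiff hup hupiff
  exact ⟨hS, hfin, hμ, hodd, h1, hle, ℓ, hℓp, hℓ1, hlow, hlowiff, hup, hupiff⟩

/-- **RANK ZERO, μ-free sandwich.** With `ι g = X` integral, first unit index `n`, `X(0) ≠ 0`, a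
(B)-datum and Prop. 3.10: `#Ш[p^∞] < ∞`, **`μ(fE) = 0`**, `λ(fE)` EVEN, `λ(fE) ≤ n`, and
**`2t ≤ LHS ≤ v_p(X(0)) + 2t`**, left `=` iff `λ(fE) = 0`, right `=` iff `λ(fE) = n`.
[cite: Delbourgo2002, Theorem (B) (p. 40)] [cite: GreenbergLNM1716, Prop. 3.10] [cite: Washington1997, §7.1] -/
theorem sandwich_rankZero_of_iota_eq_of_firstUnit
    (h310 : prop310_selmerCorank_mod_two_eq_lambdaInvariant) (hp2 : p ≠ 2)
    (hr0 : W.mordellWeilRank = 0) {Dh : PAdicHeightData W p} (hBcl : LeadingTermClauses W p Dh)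
    {κ : ZpExtension ℚ p} {γ : Field.absoluteGaloisGroup ℚ}
    (hκ : κ.IsCyclotomic) (hγ : κ.IsTopGenerator γ) (hγ' : IsCyclotomicVariable p γ)
    (D : W.SelmerDualData κ γ) [Module.Finite (IwasawaAlgebra p) D.X] (hX : D.IsTorsion)
    {fE g : IwasawaAlgebra p} (hchar : D.charIdeal = Ideal.span {fE}) (hg : g ∈ D.charIdeal)
    {X : PowerSeries ℚ_[p]} (hι : iwasawaToPowerSeries p g = X)
    {n : ℕ} (hn : ‖PowerSeries.coeff n X‖ = 1) (hlt : ∀ i < n, ‖PowerSeries.coeff i X‖ < 1)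
    (hX0 : PowerSeries.constantCoeff X ≠ 0) :
    Finite (AddCommGroup.primaryComponent W.sha p) ∧ mu fE = 0 ∧ Even (lam fE) ∧ lam fE ≤ n ∧
      ∃ ℓ : ℕ, ℓ ∣ p ^ 2 ∧ (ReductionNonAnomalous W p → ℓ = 1) ∧
        (2 : ℤ) * padicValNat p W.torsionOrder ≤
          (padicValNat p (Nat.card (AddCommGroup.primaryComponent W.sha p)) : ℤ) +
            (padicRegulator Dh).valuation + padicValNat p W.tamagawaProduct + padicValNat p ℓ ∧
        ((2 : ℤ) * padicValNat p W.torsionOrder =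
          (padicValNat p (Nat.card (AddCommGroup.primaryComponent W.sha p)) : ℤ) +
            (padicRegulator Dh).valuation + padicValNat p W.tamagawaProduct + padicValNat p ℓ ↔
          lam fE = 0) ∧
        (padicValNat p (Nat.card (AddCommGroup.primaryComponent W.sha p)) : ℤ) +
            (padicRegulator Dh).valuation + padicValNat p W.tamagawaProduct + padicValNat p ℓ ≤
          (PowerSeries.constantCoeff X).valuation + 2 * padicValNat p W.torsionOrder ∧
        ((padicValNat p (Nat.card (AddCommGroup.primaryComponent W.sha p)) : ℤ) +
            (padicRegulator Dh).valuation + padicValNat p W.tamagawaProduct + padicValNat p ℓ =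
          (PowerSeries.constantCoeff X).valuation + 2 * padicValNat p W.torsionOrder ↔ lam fE = n) := by
  have hdvd : fE ∣ g := by
    have hg' := hg
    rw [hchar] at hg'
    exact Ideal.mem_span_singleton.mp hg'
  obtain ⟨-, hμ, -⟩ := mu_eq_zero_and_lam_le_of_dvd_of_firstUnit hdvd hι hn hlt
  have hn' : ‖PowerSeries.coeff n X‖ = (p : ℝ) ^ (0 : ℕ) := by rw [pow_zero]; exact hn
  have hlt' : ∀ i < n, ‖PowerSeries.coeff i X‖ < (p : ℝ) ^ (0 : ℕ) := fun i hi ↦ by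
    rw [pow_zero]; exact hlt i hi
  obtain ⟨-, hfin, heven, -, ℓ, hℓp, hℓ1, hlow, hlowiff, hup, -, hrest⟩ :=
    sandwich_rankZero_of_iota_eq h310 hp2 hr0 hBcl hκ hγ hγ' D hX hchar hg
      (iota_eq_C_pow_zero_mul hι) (norm_coeff_le_pow_zero_of_iota_eq hι) hX0
  obtain ⟨hle, hupiff, -, -⟩ := hrest n hn' hlt'
  rw [hμ] at hlow hlowiff hup hupiff
  simp only [Nat.cast_zero, zero_add, add_zero] at hlow hlowiff hup hupiff
  exact ⟨hfin, hμ, heven, hle, ℓ, hℓp, hℓ1, hlow, hlowiff, hup, hupiff⟩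

end Sandwich

end TameBranchMuPart

end Summit.BirchSwinnertonDyer.Rank1Residual.Additive

end
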